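import Mathlib.Algebra.Order.Ring.Pow
import Mathlib.Analysis.SpecialFunctions.Pow.Real
import Mathlib.Data.Finset.Powerset
import Mathlib.Algebra.BigOperators.Ring.Finset
import HarnessLib

/-!
# Maclaurin's inequality: the `c`-th symmetric mean is at most the `c`-th power of the arithmetic mean

For nonnegative reals `f i` (`i ∈ s`, `|s| = n`) and `0 ≤ c ≤ n`, the elementary symmetric function
`e_c = Σ_{T ⊆ s, |T| = c} ∏_{i∈T} f i` satisfies `e_c ≤ C(n, c)·(e_1/n)^c`, i.e. the symmetric mean `p_c = e_c / C(n,c)` obeys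
`p_c ≤ p_1^c` [cite: HardyLittlewoodPolya1952, Thm. 52 (§2.22)] (Maclaurin 1729; the cited theorem is the full chain
`p_1 ≥ p_2^{1/2} ≥ ⋯ ≥ p_n^{1/n}`, of which this is the comparison of `p_c` with `p_1`; `c = n` is AM–GM).

Proof formalised here (elementary, no Newton inequalities): induction on the finset; the step
`C(m,c+1)μ^{c+1} + t·C(m,c)μ^c ≤ C(m+1,c+1)·((mμ + t)/(m+1))^{c+1}` is the tangent-line inequality of the convex function
`u ↦ u^{c+1}` at `u = μ` (Bernoulli's inequality `one_add_mul_le_pow`) together with Pascal's rule and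
`(m+1)·C(m,c) = (c+1)·C(m+1,c+1)`.

* (private) `pow_succ_ge_tangent` — `μ^{c+1} + (c+1)·μ^c·(u − μ) ≤ u^{c+1}` for `μ, u ≥ 0`; `maclaurin_step` — the inductive step as an
  inequality of reals; `sum_powersetCard_prod_insert` — `e_{c+1}(insert a s) = e_{c+1}(s) + f a · e_c(s)`.
* **`Literature.Analysis.Convex.sum_powersetCard_prod_le`** — Maclaurin: `Σ_{T ∈ s.powersetCard c} ∏_{i∈T} f i ≤ C(|s|, c)·((Σ_{i∈s} f i)/|s|)^c`.
-/

namespace Literature.Analysis.Convex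

section Maclaurin

open Finset

/-- The tangent-line inequality of `u ↦ u^{c+1}` at `μ ≥ 0`: `μ^{c+1} + (c+1) μ^c (u − μ) ≤ u^{c+1}` for `u ≥ 0`
(Bernoulli's inequality). [folklore] -/
private theorem pow_succ_ge_tangent (μ u : ℝ) (hμ : 0 ≤ μ) (hu : 0 ≤ u) (c : ℕ) :
    μ ^ (c + 1) + (c + 1 : ℝ) * μ ^ c * (u - μ) ≤ u ^ (c + 1) := by
  rcases hμ.eq_or_lt with h | h
  · -- `μ = 0`
    rw [← h]
    rcases Nat.eq_zero_or_pos c with hc | hc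
    · subst hc; simp
    · rw [zero_pow (by omega), zero_pow (by omega)]; simp only [mul_zero, zero_mul, zero_add]; positivity
  · -- `μ > 0`: Bernoulli with `a = u/μ − 1 ≥ −1`
    have ha : (-2 : ℝ) ≤ u / μ - 1 := by
      have : 0 ≤ u / μ := div_nonneg hu h.le
      linarith
    have hB := one_add_mul_le_pow ha (c + 1)
    have e1 : (1 : ℝ) + (u / μ - 1) = u / μ := by ring
    rw [e1, div_pow] at hB
    have hμc : 0 < μ ^ (c + 1) := pow_pos h _
    have key := mul_le_mul_of_nonneg_left hB hμc.le
    rw [mul_div_cancel₀ _ hμc.ne'] at key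
    have e2 : μ ^ (c + 1) * (1 + ((c + 1 : ℕ) : ℝ) * (u / μ - 1)) = μ ^ (c + 1) + (c + 1 : ℝ) * μ ^ c * (u - μ) := by
      push_cast
      rw [pow_succ]
      field_simp
    rw [e2] at key
    exact key

/-- **The inductive step of Maclaurin's inequality** as an inequality of reals: for `μ, t ≥ 0` and naturals `m, c`,
`C(m,c+1)·μ^{c+1} + t·C(m,c)·μ^c ≤ C(m+1,c+1)·((m·μ + t)/(m+1))^{c+1}` (tangent line at `μ` of the convex power; Pascal's rule;
`(m+1)·C(m,c) = (c+1)·C(m+1,c+1)`). [folklore] -/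
private theorem maclaurin_step (m c : ℕ) (μ t : ℝ) (hμ : 0 ≤ μ) (ht : 0 ≤ t) :
    (m.choose (c + 1) : ℝ) * μ ^ (c + 1) + t * (m.choose c : ℝ) * μ ^ c ≤
      ((m + 1).choose (c + 1) : ℝ) * (((m : ℝ) * μ + t) / ((m : ℝ) + 1)) ^ (c + 1) := by
  set u : ℝ := ((m : ℝ) * μ + t) / ((m : ℝ) + 1) with hu
  have hm1 : (0 : ℝ) < (m : ℝ) + 1 := by positivity
  have hu0 : 0 ≤ u := by rw [hu]; positivity
  have htan := pow_succ_ge_tangent μ u hμ hu0 c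
  have hpascal : (((m + 1).choose (c + 1) : ℕ) : ℝ) = (m.choose c : ℝ) + (m.choose (c + 1) : ℝ) := by
    rw [Nat.choose_succ_succ']; push_cast; ring
  have hid : ((m : ℝ) + 1) * (m.choose c : ℝ) = (((m + 1).choose (c + 1) : ℕ) : ℝ) * ((c : ℝ) + 1) := by
    have h := Nat.add_one_mul_choose_eq m c
    have h' : ((m + 1) * m.choose c : ℕ) = ((m + 1).choose (c + 1) * (c + 1) : ℕ) := h
    have h'' := congrArg (fun z : ℕ => (z : ℝ)) h'
    push_cast at h''
    linarith
  have hudiff : u - μ = (t - μ) / ((m : ℝ) + 1) := by rw [hu]; field_simp; ring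
  -- multiply the tangent inequality by `C(m+1,c+1) ≥ 0`
  have hC0 : (0 : ℝ) ≤ (((m + 1).choose (c + 1) : ℕ) : ℝ) := Nat.cast_nonneg _
  have key := mul_le_mul_of_nonneg_left htan hC0
  -- `C(m+1,c+1)·(c+1)·(u − μ) = C(m,c)·(t − μ)`
  have e : (((m + 1).choose (c + 1) : ℕ) : ℝ) * (μ ^ (c + 1) + (c + 1 : ℝ) * μ ^ c * (u - μ)) =
      (m.choose (c + 1) : ℝ) * μ ^ (c + 1) + t * (m.choose c : ℝ) * μ ^ c := by
    rw [hudiff]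
    have : (((m + 1).choose (c + 1) : ℕ) : ℝ) * ((c : ℝ) + 1) / ((m : ℝ) + 1) = (m.choose c : ℝ) := by
      rw [← hid]; field_simp
    calc (((m + 1).choose (c + 1) : ℕ) : ℝ) * (μ ^ (c + 1) + (c + 1 : ℝ) * μ ^ c * ((t - μ) / ((m : ℝ) + 1)))
        = (((m + 1).choose (c + 1) : ℕ) : ℝ) * μ ^ (c + 1) +
            ((((m + 1).choose (c + 1) : ℕ) : ℝ) * ((c : ℝ) + 1) / ((m : ℝ) + 1)) * μ ^ c * (t - μ) := by
          field_simp
      _ = (((m + 1).choose (c + 1) : ℕ) : ℝ) * μ ^ (c + 1) + (m.choose c : ℝ) * μ ^ c * (t - μ) := by rw [this]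
      _ = (m.choose (c + 1) : ℝ) * μ ^ (c + 1) + t * (m.choose c : ℝ) * μ ^ c := by
          rw [hpascal]; ring
  rw [e] at key
  exact key

variable {ι : Type*} [DecidableEq ι]

/-- `e_{c+1}(insert a s) = e_{c+1}(s) + f a · e_c(s)` for `a ∉ s`. [folklore] -/
private theorem sum_powersetCard_prod_insert (s : Finset ι) (a : ι) (ha : a ∉ s) (f : ι → ℝ) (c : ℕ) :
    ∑ T ∈ (insert a s).powersetCard (c + 1), ∏ i ∈ T, f i =
      ∑ T ∈ s.powersetCard (c + 1), ∏ i ∈ T, f i + f a * ∑ T ∈ s.powersetCard c, ∏ i ∈ T, f i := by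
  rw [Finset.powersetCard_succ_insert ha, Finset.sum_union, Finset.sum_image, Finset.mul_sum]
  · congr 1
    refine Finset.sum_congr rfl fun T hT => ?_
    have haT : a ∉ T := fun h => ha ((Finset.mem_powersetCard.1 hT).1 h)
    rw [Finset.prod_insert haT]
  · -- `insert a` is injective on subsets of `s`
    intro T₁ hT₁ T₂ hT₂ h
    have h₁ : a ∉ T₁ := fun h' => ha ((Finset.mem_powersetCard.1 hT₁).1 h')
    have h₂ : a ∉ T₂ := fun h' => ha ((Finset.mem_powersetCard.1 hT₂).1 h')
    rw [← Finset.erase_insert h₁, ← Finset.erase_insert h₂, h]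
  · -- the two parts are disjoint (sets without / with `a`)
    refine Finset.disjoint_left.2 fun T hT hT' => ?_
    have h₁ : a ∉ T := fun h' => ha ((Finset.mem_powersetCard.1 hT).1 h')
    obtain ⟨T', _, rfl⟩ := Finset.mem_image.1 hT'
    exact h₁ (Finset.mem_insert_self a T')

/-- **Maclaurin's inequality** (`p_c ≤ p_1^c`): for nonnegative reals `f i`, `i ∈ s`, and every `c`,
`Σ_{T ∈ s.powersetCard c} ∏_{i∈T} f i ≤ C(|s|, c)·((Σ_{i∈s} f i)/|s|)^c`. [cite: HardyLittlewoodPolya1952, Thm. 52 (§2.22)] -/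
theorem sum_powersetCard_prod_le (s : Finset ι) (f : ι → ℝ) (hf : ∀ i ∈ s, 0 ≤ f i) (c : ℕ) :
    ∑ T ∈ s.powersetCard c, ∏ i ∈ T, f i ≤ (s.card.choose c : ℝ) * ((∑ i ∈ s, f i) / s.card) ^ c := by
  induction s using Finset.induction_on generalizing c with
  | empty =>
    rcases Nat.eq_zero_or_pos c with hc | hc
    · subst hc; simp
    · have he : (∅ : Finset ι).powersetCard c = ∅ := Finset.powersetCard_eq_empty.2 (by simpa using hc)
      rw [he, Finset.sum_empty, Finset.card_empty, Nat.choose_eq_zero_of_lt hc]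
      simp
  | insert a s ha ih =>
    have hfs : ∀ i ∈ s, 0 ≤ f i := fun i hi => hf i (Finset.mem_insert_of_mem hi)
    have hfa : 0 ≤ f a := hf a (Finset.mem_insert_self a s)
    rcases Nat.eq_zero_or_pos c with hc | hc
    · subst hc; simp
    · obtain ⟨c, rfl⟩ : ∃ c', c = c' + 1 := ⟨c - 1, by omega⟩
      rw [sum_powersetCard_prod_insert s a ha f c, Finset.card_insert_of_notMem ha, Finset.sum_insert ha]
      set S : ℝ := ∑ i ∈ s, f i with hS
      set m : ℕ := s.card with hm
      have hμ : 0 ≤ S / m := div_nonneg (Finset.sum_nonneg hfs) (Nat.cast_nonneg _)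
      have h1 := ih hfs (c + 1)
      have h2 := ih hfs c
      have hstep := maclaurin_step m c (S / m) (f a) hμ hfa
      have hSm : (m : ℝ) * (S / m) = S := by
        rcases Nat.eq_zero_or_pos m with h0 | h0
        · have hs0 : s = ∅ := Finset.card_eq_zero.1 (hm ▸ h0)
          have : S = 0 := by rw [hS, hs0, Finset.sum_empty]
          rw [this]; simp
        · field_simp
      rw [hSm] at hstep
      have e : (f a + S) / (((m + 1 : ℕ) : ℝ)) = (S + f a) / ((m : ℝ) + 1) := by push_cast; ring
      rw [e]
      calc ∑ T ∈ s.powersetCard (c + 1), ∏ i ∈ T, f i + f a * ∑ T ∈ s.powersetCard c, ∏ i ∈ T, f i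
          ≤ (m.choose (c + 1) : ℝ) * (S / m) ^ (c + 1) + f a * ((m.choose c : ℝ) * (S / m) ^ c) :=
            add_le_add h1 (mul_le_mul_of_nonneg_left h2 hfa)
        _ = (m.choose (c + 1) : ℝ) * (S / m) ^ (c + 1) + f a * (m.choose c : ℝ) * (S / m) ^ c := by ring
        _ ≤ ((m + 1).choose (c + 1) : ℝ) * ((S + f a) / ((m : ℝ) + 1)) ^ (c + 1) := hstep

/-- Maclaurin's inequality in symmetric-mean form: `e_c / C(n,c) ≤ (e_1/n)^c` (`n = |s| ≥ c`, so that `C(n,c) > 0`).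
[cite: HardyLittlewoodPolya1952, Thm. 52 (§2.22)] -/
theorem symmMean_le_arithMean_pow (s : Finset ι) (f : ι → ℝ) (hf : ∀ i ∈ s, 0 ≤ f i) (c : ℕ) (hc : c ≤ s.card) :
    (∑ T ∈ s.powersetCard c, ∏ i ∈ T, f i) / (s.card.choose c : ℝ) ≤ ((∑ i ∈ s, f i) / s.card) ^ c := by
  have hpos : (0 : ℝ) < (s.card.choose c : ℝ) := by exact_mod_cast Nat.choose_pos hc
  rw [div_le_iff₀ hpos, mul_comm]
  exact sum_powersetCard_prod_le s f hf c

end Maclaurin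

end Literature.Analysis.Convex
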